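import Summits.QuantumFields.YangMills.Theorems.LuscherReductionOneSiteLevelsPhaseDefs
import Summits.QuantumFields.YangMills.Theorems.LuscherReductionOneSiteLevelsPhysClass
import Summits.QuantumFields.YangMills.Theorems.LuscherReductionOneSiteLevelsAbsUpperSeam

/-!
# The IMS phase `onePhase ℓ`: measurability, gauge/twist invariance, link-Lipschitz bound `π/(2ℓ)`, support, and the `O(λ_b²)` scale
# (support module for the registered stub `stub_absUpper` of crux `OneSiteLevels`, route `LuscherReduction`, item stmt-QuantumFields-20007;
# fleet lead prover ym-luscher-20007-p1)

Discharges the (PHASE) hypotheses of the composition seam `absUpper_of_localized` (`Theorems/LuscherReductionOneSiteLevelsAbsUpperSeam.lean`)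
for the phases `onePhase (onePhaseScale B)` of `Theorems/LuscherReductionOneSiteLevelsPhaseDefs.lean`:
`measurable_onePhase`, `onePhase_gaugeTransform`, `onePhase_twist`, `abs_onePhase_sub_le` (Lipschitz constant `π/(2ℓ)` against
`Σ_e ‖U_e − V_e‖_F`, from `|Π a_e − Π b_e| ≤ Σ_e |a_e − b_e|` on `[0,1]`, the 1-Lipschitz ramp `clamp01` and the 1-Lipschitz `vacDist`),
`onePhaseScale_lipschitzSq` (`(π/(2ℓ))² = (π²/4)/λ_b` at `ℓ = √λ_b`), and the support lemmas `onePhase_eq_zero` / `onePhase_eq_pi_div_two`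
(`cos Θ·ψ` lives where every link has `vacDist < 2ℓ`; `sin Θ·ψ` lives where some link has `vacDist > ℓ`).  With these, `stub_absUpper` is
EXACTLY (INNER) + (OUTER) of the seam for this phase (`absUpper_of_onePhase`).

## WHAT THIS IS NOT
No analytic bound; NOT the crux, NOT THE CLAY GAP.  Sorry-free; no named fact.
-/

set_option autoImplicit false

noncomputable section

open MeasureTheory Filter Topology Real
open scoped Matrix ComplexConjugate BigOperators
open Literature.MathematicalPhysics.QuantumFieldTheory
open Literature.MathematicalPhysics.QuantumLattice
open Literature.Analysis.OperatorTheory.YMMatrixModel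

namespace Summit.QuantumFields.YangMills.Theorems.FemtoTransferGap

/-! ### §1. Products of `[0,1]`-valued families are 1-Lipschitz in `ℓ¹` -/

/-- `|Π_{s} a − Π_{s} b| ≤ Σ_{s} |a − b|` for `[0,1]`-valued families (telescoping). [folklore] -/
theorem abs_prod_sub_prod_le_sum {ι : Type*} (s : Finset ι) (a b : ι → ℝ)
    (ha0 : ∀ i, 0 ≤ a i) (ha1 : ∀ i, a i ≤ 1) (hb0 : ∀ i, 0 ≤ b i) (hb1 : ∀ i, b i ≤ 1) :
    |∏ i ∈ s, a i - ∏ i ∈ s, b i| ≤ ∑ i ∈ s, |a i - b i| := by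
  classical
  induction s using Finset.induction_on with
  | empty => simp
  | @insert j s hj ih =>
    rw [Finset.prod_insert hj, Finset.prod_insert hj, Finset.sum_insert hj]
    have hPa0 : 0 ≤ ∏ i ∈ s, a i := Finset.prod_nonneg fun i _ => ha0 i
    have hPa1 : ∏ i ∈ s, a i ≤ 1 := Finset.prod_le_one (fun i _ => ha0 i) (fun i _ => ha1 i)
    have hPb0 : 0 ≤ ∏ i ∈ s, b i := Finset.prod_nonneg fun i _ => hb0 i
    have hPb1 : ∏ i ∈ s, b i ≤ 1 := Finset.prod_le_one (fun i _ => hb0 i) (fun i _ => hb1 i)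
    -- `a_j A − b_j B = (a_j − b_j) A + b_j (A − B)`
    have e : a j * ∏ i ∈ s, a i - b j * ∏ i ∈ s, b i
        = (a j - b j) * ∏ i ∈ s, a i + b j * (∏ i ∈ s, a i - ∏ i ∈ s, b i) := by ring
    rw [e]
    calc |(a j - b j) * ∏ i ∈ s, a i + b j * (∏ i ∈ s, a i - ∏ i ∈ s, b i)|
        ≤ |(a j - b j) * ∏ i ∈ s, a i| + |b j * (∏ i ∈ s, a i - ∏ i ∈ s, b i)| := abs_add_le _ _
      _ = |a j - b j| * (∏ i ∈ s, a i) + b j * |∏ i ∈ s, a i - ∏ i ∈ s, b i| := by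
          rw [abs_mul, abs_mul, abs_of_nonneg hPa0, abs_of_nonneg (hb0 j)]
      _ ≤ |a j - b j| * 1 + 1 * |∏ i ∈ s, a i - ∏ i ∈ s, b i| :=
          add_le_add (mul_le_mul_of_nonneg_left hPa1 (abs_nonneg _)) (mul_le_mul_of_nonneg_right (hb1 j) (abs_nonneg _))
      _ ≤ |a j - b j| + ∑ i ∈ s, |a i - b i| := by rw [mul_one, one_mul]; exact add_le_add le_rfl ih

/-! ### §2. The phase: range, measurability, invariance -/

/-- The ramp factor of a link lies in `[0,1]`. [folklore] -/
theorem linkRamp_mem (ℓ : ℝ) (W : SU2) : 0 ≤ clamp01 (2 - vacDist W / ℓ) ∧ clamp01 (2 - vacDist W / ℓ) ≤ 1 :=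
  ⟨clamp01_nonneg _, clamp01_le_one _⟩

/-- `0 ≤ Θ_ℓ ≤ π/2`. [folklore] -/
theorem onePhase_mem (ℓ : ℝ) (U : Cfg) : 0 ≤ onePhase ℓ U ∧ onePhase ℓ U ≤ Real.pi / 2 := by
  unfold onePhase
  have hP0 : 0 ≤ ∏ e : Edge 3 1, clamp01 (2 - vacDist (U e) / ℓ) := Finset.prod_nonneg fun e _ => clamp01_nonneg _
  have hP1 : ∏ e : Edge 3 1, clamp01 (2 - vacDist (U e) / ℓ) ≤ 1 :=
    Finset.prod_le_one (fun e _ => clamp01_nonneg _) (fun e _ => clamp01_le_one _)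
  have hpi : 0 < Real.pi / 2 := by positivity
  constructor
  · exact mul_nonneg hpi.le (by linarith)
  · nlinarith

/-- The phase is continuous, hence measurable. [folklore] -/
theorem continuous_onePhase (ℓ : ℝ) : Continuous (onePhase ℓ) := by
  unfold onePhase
  refine continuous_const.mul (continuous_const.sub ?_)
  refine continuous_finsetProd _ fun e _ => ?_
  exact continuous_clamp01.comp (continuous_const.sub ((continuous_vacDist.comp (continuous_apply e)).div_const ℓ))

/-- The phase is measurable. [folklore] -/
theorem measurable_onePhase (ℓ : ℝ) : Measurable (onePhase ℓ) := by
  haveI := secondCountableTopology_su2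
  exact (continuous_onePhase ℓ).measurable

/-- Gauge invariance of the phase (`L = 1`: simultaneous conjugation; `vacDist` is a class function). [folklore] -/
theorem onePhase_gaugeTransform (ℓ : ℝ) (g : Site 3 1 → SU2) (U : Cfg) : onePhase ℓ (gaugeTransform g U) = onePhase ℓ U := by
  unfold onePhase
  congr 2
  exact Finset.prod_congr rfl fun e _ => by rw [gaugeTransform_one_site, vacDist_conj]

/-- Twist (zero-flux) invariance of the phase (`vacDist (zW) = vacDist W` for central `z`). [cite: tHooft1979] -/
theorem onePhase_twist (ℓ : ℝ) (k : Fin 3) {z : SU2} (hz : z ∈ Subgroup.center SU2) (U : Cfg) :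
    onePhase ℓ (twist k z U) = onePhase ℓ U := by
  unfold onePhase
  congr 2
  refine Finset.prod_congr rfl fun e _ => ?_
  rcases twist_apply_eq_or k z U e with h | h
  · rw [h, vacDist_center_mul hz]
  · rw [h]

/-! ### §3. The link-Lipschitz bound -/

/-- **The phase is link-Lipschitz with constant `π/(2ℓ)`**: `|Θ_ℓ(U) − Θ_ℓ(V)| ≤ (π/(2ℓ)) Σ_e ‖U_e − V_e‖_F` (`ℓ > 0`). [folklore] -/
theorem abs_onePhase_sub_le {ℓ : ℝ} (hℓ : 0 < ℓ) (U V : Cfg) :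
    |onePhase ℓ U - onePhase ℓ V|
      ≤ (Real.pi / 2 / ℓ) * ∑ e, frobNorm ((U e : Matrix (Fin 2) (Fin 2) ℂ) - (V e : Matrix (Fin 2) (Fin 2) ℂ)) := by
  unfold onePhase
  have hpi : 0 ≤ Real.pi / 2 := by positivity
  have e1 : Real.pi / 2 * (1 - ∏ e : Edge 3 1, clamp01 (2 - vacDist (U e) / ℓ))
      - Real.pi / 2 * (1 - ∏ e : Edge 3 1, clamp01 (2 - vacDist (V e) / ℓ))
      = Real.pi / 2 * (∏ e : Edge 3 1, clamp01 (2 - vacDist (V e) / ℓ) - ∏ e : Edge 3 1, clamp01 (2 - vacDist (U e) / ℓ)) := by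
    ring
  rw [e1, abs_mul, abs_of_nonneg hpi]
  have hprod := abs_prod_sub_prod_le_sum (Finset.univ : Finset (Edge 3 1))
    (fun e => clamp01 (2 - vacDist (V e) / ℓ)) (fun e => clamp01 (2 - vacDist (U e) / ℓ))
    (fun e => clamp01_nonneg _) (fun e => clamp01_le_one _) (fun e => clamp01_nonneg _) (fun e => clamp01_le_one _)
  have hterm : ∀ e : Edge 3 1, |clamp01 (2 - vacDist (V e) / ℓ) - clamp01 (2 - vacDist (U e) / ℓ)|
      ≤ frobNorm ((U e : Matrix (Fin 2) (Fin 2) ℂ) - (V e : Matrix (Fin 2) (Fin 2) ℂ)) / ℓ := by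
    intro e
    calc |clamp01 (2 - vacDist (V e) / ℓ) - clamp01 (2 - vacDist (U e) / ℓ)|
        ≤ |(2 - vacDist (V e) / ℓ) - (2 - vacDist (U e) / ℓ)| := abs_clamp01_sub_le _ _
      _ = |vacDist (U e) - vacDist (V e)| / ℓ := by
          rw [show (2 - vacDist (V e) / ℓ) - (2 - vacDist (U e) / ℓ) = (vacDist (U e) - vacDist (V e)) / ℓ by ring,
            abs_div, abs_of_pos hℓ]
      _ ≤ frobNorm ((U e : Matrix (Fin 2) (Fin 2) ℂ) - (V e : Matrix (Fin 2) (Fin 2) ℂ)) / ℓ :=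
          div_le_div_of_nonneg_right (abs_vacDist_sub_le _ _) hℓ.le
  calc Real.pi / 2 * |∏ e : Edge 3 1, clamp01 (2 - vacDist (V e) / ℓ) - ∏ e : Edge 3 1, clamp01 (2 - vacDist (U e) / ℓ)|
      ≤ Real.pi / 2 * ∑ e, frobNorm ((U e : Matrix (Fin 2) (Fin 2) ℂ) - (V e : Matrix (Fin 2) (Fin 2) ℂ)) / ℓ :=
        mul_le_mul_of_nonneg_left (hprod.trans (Finset.sum_le_sum fun e _ => hterm e)) hpi
    _ = (Real.pi / 2 / ℓ) * ∑ e, frobNorm ((U e : Matrix (Fin 2) (Fin 2) ℂ) - (V e : Matrix (Fin 2) (Fin 2) ℂ)) := by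
        rw [← Finset.sum_div]
        ring

/-! ### §4. Support: where the two pieces live -/

/-- `Θ_ℓ(U) = 0` when every link is within `ℓ` of the centre (then `cos Θ = 1`, `sin Θ = 0`: the INNER region). [folklore] -/
theorem onePhase_eq_zero {ℓ : ℝ} (hℓ : 0 < ℓ) {U : Cfg} (hU : ∀ e, vacDist (U e) ≤ ℓ) : onePhase ℓ U = 0 := by
  unfold onePhase
  have h1 : ∏ e : Edge 3 1, clamp01 (2 - vacDist (U e) / ℓ) = 1 := by
    refine Finset.prod_eq_one fun e _ => clamp01_of_one_le ?_
    have : vacDist (U e) / ℓ ≤ 1 := (div_le_one hℓ).mpr (hU e)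
    linarith
  rw [h1, sub_self, mul_zero]

/-- `Θ_ℓ(U) = π/2` when some link is at distance `≥ 2ℓ` from the centre (then `cos Θ = 0`: the OUTER region). [folklore] -/
theorem onePhase_eq_pi_div_two {ℓ : ℝ} (hℓ : 0 < ℓ) {U : Cfg} {e : Edge 3 1} (hU : 2 * ℓ ≤ vacDist (U e)) :
    onePhase ℓ U = Real.pi / 2 := by
  unfold onePhase
  have h0 : clamp01 (2 - vacDist (U e) / ℓ) = 0 := by
    refine clamp01_of_nonpos ?_
    have : 2 ≤ vacDist (U e) / ℓ := (le_div_iff₀ hℓ).mpr (by linarith)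
    linarith
  rw [Finset.prod_eq_zero (Finset.mem_univ e) h0, sub_zero, mul_one]

/-- If the `cos`-piece does not vanish at `U`, every link of `U` is within `2ℓ` of the centre. [folklore] -/
theorem vacDist_lt_of_cos_onePhase_ne_zero {ℓ : ℝ} (hℓ : 0 < ℓ) {U : Cfg} (h : Real.cos (onePhase ℓ U) ≠ 0) (e : Edge 3 1) :
    vacDist (U e) < 2 * ℓ := by
  by_contra hge
  push Not at hge
  exact h (by rw [onePhase_eq_pi_div_two hℓ hge, Real.cos_pi_div_two])

/-- If the `sin`-piece does not vanish at `U`, some link of `U` is farther than `ℓ` from the centre. [folklore] -/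
theorem exists_vacDist_gt_of_sin_onePhase_ne_zero {ℓ : ℝ} (hℓ : 0 < ℓ) {U : Cfg} (h : Real.sin (onePhase ℓ U) ≠ 0) :
    ∃ e : Edge 3 1, ℓ < vacDist (U e) := by
  by_contra hall
  push Not at hall
  exact h (by rw [onePhase_eq_zero hℓ hall, Real.sin_zero])

/-! ### §5. The scale `ℓ(B) = √λ_b`: Lipschitz constant squared `= (π²/4)/λ_b` -/

/-- `0 < ℓ(B)` for `B > 0`. [cite: Luscher1983, §1] -/
theorem onePhaseScale_pos {B : ℝ} (hB : 0 < B) : 0 < onePhaseScale B := by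
  unfold onePhaseScale bareLambda
  exact Real.sqrt_pos.mpr (Real.rpow_pos_of_pos (by positivity) _)

/-- `ℓ(B)² = λ_b(B)` (`B > 0`). [cite: Luscher1983, §1] -/
theorem onePhaseScale_sq {B : ℝ} (hB : 0 < B) : onePhaseScale B ^ 2 = bareLambda B := by
  unfold onePhaseScale
  rw [Real.sq_sqrt]
  unfold bareLambda
  exact (Real.rpow_pos_of_pos (by positivity) _).le

/-- The squared Lipschitz constant at the IMS scale: `(π/(2ℓ(B)))² ≤ (π²/4)/λ_b(B)` (in fact `=`). [cite: SimonB1983DiscreteSpectrum, §3] -/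
theorem onePhaseScale_lipschitzSq {B : ℝ} (hB : 0 < B) :
    (Real.pi / 2 / onePhaseScale B) ^ 2 ≤ (Real.pi ^ 2 / 4) / bareLambda B := by
  rw [div_pow, div_pow, onePhaseScale_sq hB]
  norm_num

/-! ### §6. `stub_absUpper` = INNER + OUTER for this phase -/

/-- **`stub_absUpper` reduced to INNER + OUTER for the phase `onePhase (onePhaseScale B)`.**  If for `B ≥ B₁ ≥ 2` (INNER) some `k` physical
constraints control the `cos Θ_B`-piece of every physical `ψ ⊥ φ_i` at rate `linkCE B · e^{−E_kλ_b + C₁λ_b²}` and (OUTER) the `sin Θ_B`-piece of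
every physical `ψ` obeys the same rate, then `OneSiteAbsUpper k` holds (`oneLinkFactor = linkC`):
`∃ C B0, ∀ B ≥ B0, λ_k ≤ linkC B ^ 3 · e^{−E_kλ_b + Cλ_b²}`. [cite: SimonB1983DiscreteSpectrum, §3] [cite: ReedSimonIV1978, Thm. XIII.1] -/
theorem absUpper_of_onePhase (k : ℕ) {C₁ B₁ : ℝ} (hB₁ : 2 ≤ B₁)
    (hin : ∀ B, B₁ ≤ B → ∃ φs : Fin k → Cfg → ℝ, (∀ i, IsPhys (φs i)) ∧ ∀ ψ : Cfg → ℝ, IsPhys ψ → (∀ i, l2 ψ (φs i) = 0) →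
      qform su2Rep B (fun U => Real.cos (onePhase (onePhaseScale B) U) * ψ U) (fun U => Real.cos (onePhase (onePhaseScale B) U) * ψ U)
        ≤ linkCE B * Real.exp (-(physLevel (k + 1) * bareLambda B) + C₁ * bareLambda B ^ 2)
          * l2 (fun U => Real.cos (onePhase (onePhaseScale B) U) * ψ U) (fun U => Real.cos (onePhase (onePhaseScale B) U) * ψ U))
    (hout : ∀ B, B₁ ≤ B → ∀ ψ : Cfg → ℝ, IsPhys ψ →
      qform su2Rep B (fun U => Real.sin (onePhase (onePhaseScale B) U) * ψ U) (fun U => Real.sin (onePhase (onePhaseScale B) U) * ψ U)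
        ≤ linkCE B * Real.exp (-(physLevel (k + 1) * bareLambda B) + C₁ * bareLambda B ^ 2)
          * l2 (fun U => Real.sin (onePhase (onePhaseScale B) U) * ψ U) (fun U => Real.sin (onePhase (onePhaseScale B) U) * ψ U)) :
    ∃ C B0 : ℝ, ∀ B : ℝ, B0 ≤ B →
      levelValue su2Rep 1 B k ≤ linkC B ^ 3 * Real.exp (-(physLevel (k + 1) * bareLambda B) + C * bareLambda B ^ 2) := by
  have hpos : ∀ B, B₁ ≤ B → 0 < B := fun B hB => by linarith
  -- phase family at scale ℓ(max B B₁) (= ℓ(B) for B ≥ B₁; keeps the Lipschitz data meaningful for every real B)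
  have hmax : ∀ B, 0 < max B B₁ := fun B => lt_of_lt_of_le (by linarith) (le_max_right B B₁)
  refine absUpper_of_localized k (A := Real.pi ^ 2 / 4) (C₁ := C₁) (B₁ := B₁) hB₁ (by positivity)
    (fun B => onePhase (onePhaseScale (max B B₁))) (fun B => Real.pi / 2 / onePhaseScale (max B B₁))
    (fun B => measurable_onePhase _) (fun B g U => onePhase_gaugeTransform _ g U)
    (fun B j z hz U => onePhase_twist _ j hz U)
    (fun B => div_nonneg (by positivity) (onePhaseScale_pos (hmax B)).le)
    (fun B U V => abs_onePhase_sub_le (onePhaseScale_pos (hmax B)) U V)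
    (fun B hB => ?_) (fun B hB => ?_) (fun B hB => ?_)
  · rw [max_eq_left hB]
    exact onePhaseScale_lipschitzSq (hpos B hB)
  · simp only [max_eq_left hB]
    exact hin B hB
  · simp only [max_eq_left hB]
    exact hout B hB

/-- **`stub_absUpper k` from INNER and OUTER with independent constants** (the registrable form: each of the two analytic sub-stubs carries
its own `∃ C B₁`; rates are monotone in the constant). [cite: SimonB1983DiscreteSpectrum, §3] [cite: ReedSimonIV1978, Thm. XIII.1] -/
theorem absUpper_of_inner_outer (k : ℕ)
    (hin : ∃ C₁ B₁ : ℝ, 2 ≤ B₁ ∧ ∀ B, B₁ ≤ B → ∃ φs : Fin k → Cfg → ℝ, (∀ i, IsPhys (φs i)) ∧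
      ∀ ψ : Cfg → ℝ, IsPhys ψ → (∀ i, l2 ψ (φs i) = 0) →
      qform su2Rep B (fun U => Real.cos (onePhase (onePhaseScale B) U) * ψ U) (fun U => Real.cos (onePhase (onePhaseScale B) U) * ψ U)
        ≤ linkCE B * Real.exp (-(physLevel (k + 1) * bareLambda B) + C₁ * bareLambda B ^ 2)
          * l2 (fun U => Real.cos (onePhase (onePhaseScale B) U) * ψ U) (fun U => Real.cos (onePhase (onePhaseScale B) U) * ψ U))
    (hout : ∃ C₂ B₂ : ℝ, 2 ≤ B₂ ∧ ∀ B, B₂ ≤ B → ∀ ψ : Cfg → ℝ, IsPhys ψ →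
      qform su2Rep B (fun U => Real.sin (onePhase (onePhaseScale B) U) * ψ U) (fun U => Real.sin (onePhase (onePhaseScale B) U) * ψ U)
        ≤ linkCE B * Real.exp (-(physLevel (k + 1) * bareLambda B) + C₂ * bareLambda B ^ 2)
          * l2 (fun U => Real.sin (onePhase (onePhaseScale B) U) * ψ U) (fun U => Real.sin (onePhase (onePhaseScale B) U) * ψ U)) :
    ∃ C B0 : ℝ, ∀ B : ℝ, B0 ≤ B →
      levelValue su2Rep 1 B k ≤ linkC B ^ 3 * Real.exp (-(physLevel (k + 1) * bareLambda B) + C * bareLambda B ^ 2) := by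
  obtain ⟨C₁, B₁, hB₁, h₁⟩ := hin
  obtain ⟨C₂, B₂, hB₂, h₂⟩ := hout
  -- common constants
  have hrate : ∀ {C C' : ℝ} (B : ℝ), C ≤ C' → 0 < B →
      linkCE B * Real.exp (-(physLevel (k + 1) * bareLambda B) + C * bareLambda B ^ 2)
        ≤ linkCE B * Real.exp (-(physLevel (k + 1) * bareLambda B) + C' * bareLambda B ^ 2) := by
    intro C C' B hC hB
    refine mul_le_mul_of_nonneg_left (Real.exp_le_exp.mpr ?_) (linkCE_pos hB.le).le
    nlinarith [sq_nonneg (bareLambda B)]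
  have hl2nn : ∀ (f : Cfg → ℝ), 0 ≤ l2 f f := fun f => by unfold l2; exact integral_nonneg fun U => mul_self_nonneg _
  refine absUpper_of_onePhase k (C₁ := max C₁ C₂) (B₁ := max B₁ B₂) (hB₁.trans (le_max_left _ _)) (fun B hB => ?_) (fun B hB ψ hψ => ?_)
  · have hB1 : B₁ ≤ B := (le_max_left _ _).trans hB
    have hBpos : 0 < B := by linarith
    obtain ⟨φs, hφ, hψs⟩ := h₁ B hB1
    exact ⟨φs, hφ, fun ψ hψ horth => (hψs ψ hψ horth).trans
      (mul_le_mul_of_nonneg_right (hrate B (le_max_left C₁ C₂) hBpos) (hl2nn _))⟩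
  · have hB2 : B₂ ≤ B := (le_max_right _ _).trans hB
    have hBpos : 0 < B := by linarith
    exact (h₂ B hB2 ψ hψ).trans (mul_le_mul_of_nonneg_right (hrate B (le_max_right C₁ C₂) hBpos) (hl2nn _))

end Summit.QuantumFields.YangMills.Theorems.FemtoTransferGap

end
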